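import Summits.Ventures.PercRepro.ThetaSigmaSep

/-!
# The separated (Σ)-count: the partners pay the `q`-edges, and the two hand-counted families

Dossier proofs/MINE1-theoremS.md, Addendum 77 (mine-1, gen 40). The **consistent partners** at a
point `q` are the `q`-free members `x` with `x + q ∈ X` (`partners q X`); the projection `π_q X`
loses exactly them (`card_image_erase_add_card_partners`). They are paid by the `q`-edges of the
two halves of the separated count (`ThetaSigmaSep.lean`):

* the meet of two distinct partners is a `q`-edge of the meet family
  (`inf_mem_qEdges_sigmaMeets`), their relative co-join a `q`-edge of the co-join family
  (`sdiff_sup_mem_qEdges_sigmaCojoins`) — both halves get their own credit, which is what makes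
  the separated count inductive;
* a single partner is paid by any third member (`exists_mem_qEdges_of_third`);
* **the credit lemma** `card_partners_le_card_qEdges`: with at least four members and the strict
  separated inequality available on `U \ q` (used only for three or more partners),
  `|partners| ≤ |meet edges| + |co-join edges|`.

The two families the induction cannot project are counted by hand: three distinct sets have
meets + co-joins ≥ 4 (`four_le_sepCount_of_three`, through the lattice cancellation
`inf_ne_inf_of_sup_eq_of_ne`), and the square `{x, x + q, y, y + q}` has ≥ 5
(`five_le_sepCount_square`).
-/

namespace PercRepro.MSTight

open Finset

variable {α : Type*} [DecidableEq α]

section Partners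

variable {q : α} {U : Finset α} {X : Finset (Finset α)}

/-- The **consistent partners** at `q`: the `q`-free members `x` with `x + q ∈ X`. -/
def partners (q : α) (X : Finset (Finset α)) : Finset (Finset α) :=
  X.filter fun x => q ∉ x ∧ insert q x ∈ X

/-- Membership in the partner family. -/
theorem mem_partners {x : Finset α} : x ∈ partners q X ↔ x ∈ X ∧ q ∉ x ∧ insert q x ∈ X := by
  unfold partners
  rw [mem_filter]

/-- Two distinct partners have distinct lifts. -/
theorem insert_ne_insert_of_partners {x y : Finset α} (hx : x ∈ partners q X)
    (hy : y ∈ partners q X) (hxy : x ≠ y) : insert q x ≠ insert q y := by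
  rw [mem_partners] at hx hy
  intro h
  apply hxy
  have this : (insert q x).erase q = (insert q y).erase q := by rw [h]
  rwa [erase_insert hx.2.1, erase_insert hy.2.1] at this

/-- The partners and their lifts are disjoint subfamilies of `X` of the same size: `2|K| ≤ |X|`. -/
theorem two_mul_card_partners_le (q : α) (X : Finset (Finset α)) :
    2 * (partners q X).card ≤ X.card := by
  have hsub : partners q X ∪ (partners q X).image (fun x => insert q x) ⊆ X := by
    intro z hz
    rcases mem_union.1 hz with hz | hz
    · exact (mem_partners.1 hz).1
    · obtain ⟨x, hx, rfl⟩ := mem_image.1 hz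
      exact (mem_partners.1 hx).2.2
  have hdisj : Disjoint (partners q X) ((partners q X).image fun x => insert q x) := by
    rw [disjoint_left]
    intro z hz hz'
    obtain ⟨x, hx, rfl⟩ := mem_image.1 hz'
    exact (mem_partners.1 hz).2.1 (mem_insert_self q x)
  have hinj : Set.InjOn (fun x : Finset α => insert q x) (partners q X) := by
    intro x hx y hy hxy
    by_contra hne
    exact insert_ne_insert_of_partners hx hy hne hxy
  have := card_le_card hsub
  rw [card_union_of_disjoint hdisj, card_image_of_injOn hinj] at this
  omega

/-- **The meet credit**: the meet of two distinct partners is a `q`-edge of the meet family. -/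
theorem inf_mem_qEdges_sigmaMeets {x y : Finset α} (hx : x ∈ partners q X)
    (hy : y ∈ partners q X) (hxy : x ≠ y) : x ⊓ y ∈ qEdges q (sigmaMeets X) := by
  have hne := insert_ne_insert_of_partners hx hy hxy
  rw [mem_partners] at hx hy
  rw [mem_qEdges]
  refine ⟨inf_mem_sigmaMeets hxy hx.1 hy.1, ?_, ?_⟩
  · simp only [inf_eq_inter, mem_inter, not_and]
    exact fun h => absurd h hx.2.1
  · have := inf_mem_sigmaMeets hne hx.2.2 hy.2.2
    rwa [inf_eq_inter, ← insert_inter_distrib, ← inf_eq_inter] at this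

/-- **The co-join credit**: the relative co-join (in `U \ q`) of two distinct partners is a
`q`-edge of the co-join family. -/
theorem sdiff_sup_mem_qEdges_sigmaCojoins (hqU : q ∈ U) {x y : Finset α}
    (hx : x ∈ partners q X) (hy : y ∈ partners q X) (hxy : x ≠ y) :
    U.erase q \ (x ⊔ y) ∈ qEdges q (sigmaCojoins U X) := by
  have hne := insert_ne_insert_of_partners hx hy hxy
  rw [mem_partners] at hx hy
  have hqx := hx.2.1
  have hqy := hy.2.1
  rw [mem_qEdges]
  refine ⟨?_, ?_, ?_⟩
  · have := sdiff_sup_mem_sigmaCojoins (U := U) hne hx.2.2 hy.2.2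
    convert this using 1
    ext a
    simp only [mem_sdiff, mem_erase, sup_eq_union, mem_union, mem_insert]
    tauto
  · simp [mem_sdiff, mem_erase]
  · have := sdiff_sup_mem_sigmaCojoins (U := U) hxy hx.1 hy.1
    convert this using 1
    ext a
    simp only [mem_insert, mem_sdiff, mem_erase, sup_eq_union, mem_union]
    constructor
    · rintro (rfl | ⟨⟨-, hU⟩, hn⟩)
      · exact ⟨hqU, fun h => h.elim (fun h => hqx h) (fun h => hqy h)⟩
      · exact ⟨hU, hn⟩
    · rintro ⟨hU, hn⟩
      by_cases h : a = q
      · exact Or.inl h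
      · exact Or.inr ⟨⟨h, hU⟩, hn⟩

/-- **A single partner pays itself through any third member**: a member `u ∉ {x, x + q}` gives
a `q`-edge in one of the two halves. -/
theorem exists_mem_qEdges_of_third (hqU : q ∈ U) {x u : Finset α} (hx : x ∈ partners q X)
    (hu : u ∈ X) (hux : u ≠ x) (hux' : u ≠ insert q x) :
    (qEdges q (sigmaMeets X)).Nonempty ∨ (qEdges q (sigmaCojoins U X)).Nonempty := by
  rw [mem_partners] at hx
  have hqx := hx.2.1
  by_cases hqu : q ∈ u
  · left
    refine ⟨x ⊓ u, ?_⟩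
    rw [mem_qEdges]
    refine ⟨inf_mem_sigmaMeets hux.symm hx.1 hu, ?_, ?_⟩
    · simp only [inf_eq_inter, mem_inter, not_and]
      exact fun h => absurd h hqx
    · have := inf_mem_sigmaMeets hux'.symm hx.2.2 hu
      convert this using 1
      ext a
      simp only [mem_insert, inf_eq_inter, mem_inter]
      constructor
      · rintro (rfl | ⟨h1, h2⟩)
        · exact ⟨Or.inl rfl, hqu⟩
        · exact ⟨Or.inr h1, h2⟩
      · rintro ⟨h1 | h1, h2⟩
        · exact Or.inl h1
        · exact Or.inr ⟨h1, h2⟩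
  · right
    refine ⟨U.erase q \ (x ⊔ u), ?_⟩
    rw [mem_qEdges]
    refine ⟨?_, ?_, ?_⟩
    · have := sdiff_sup_mem_sigmaCojoins (U := U) hux'.symm hx.2.2 hu
      convert this using 1
      ext a
      simp only [mem_sdiff, mem_erase, sup_eq_union, mem_union, mem_insert]
      tauto
    · simp [mem_sdiff, mem_erase]
    · have := sdiff_sup_mem_sigmaCojoins (U := U) hux.symm hx.1 hu
      convert this using 1
      ext a
      simp only [mem_insert, mem_sdiff, mem_erase, sup_eq_union, mem_union]
      constructor
      · rintro (rfl | ⟨⟨-, hU⟩, hn⟩)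
        · exact ⟨hqU, fun h => h.elim (fun h => hqx h) (fun h => hqu h)⟩
        · exact ⟨hU, hn⟩
      · rintro ⟨hU, hn⟩
        by_cases h : a = q
        · exact Or.inl h
        · exact Or.inr ⟨⟨h, hU⟩, hn⟩

end Partners

section Small

variable {U : Finset α}

/-- In the distributive lattice of finsets, the pair `(a ⊔ b, a ⊓ b)` determines `b`: equal joins
with `a` and distinct `b ≠ c` force distinct meets with `a`. -/
theorem inf_ne_inf_of_sup_eq_of_ne {a b c : Finset α} (h : a ⊔ b = a ⊔ c) (hbc : b ≠ c) :
    a ⊓ b ≠ a ⊓ c := by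
  intro h'
  apply hbc
  exact eq_of_inf_eq_sup_eq (by rw [inf_comm, h', inf_comm]) (by rw [sup_comm, h, sup_comm])

/-- Relative complementation is injective on subsets of `U`. -/
theorem sup_eq_sup_of_sdiff_eq {x y z : Finset α} (hx : x ⊆ U) (hy : y ⊆ U) (hz : z ⊆ U)
    (h : U \ (x ⊔ y) = U \ (x ⊔ z)) : x ⊔ y = x ⊔ z := by
  have h1 : x ⊔ y ⊆ U := by rw [sup_eq_union]; exact union_subset hx hy
  have h2 : x ⊔ z ⊆ U := by rw [sup_eq_union]; exact union_subset hx hz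
  rw [← Finset.sdiff_sdiff_eq_self h1, h, Finset.sdiff_sdiff_eq_self h2]

/-- **Three sets**: for three distinct subsets of `U`, meets + co-joins ≥ 4. -/
theorem four_le_sepCount_of_three {x y z : Finset α} (hx : x ⊆ U) (hy : y ⊆ U) (hz : z ⊆ U)
    (hxy : x ≠ y) (hxz : x ≠ z) (hyz : y ≠ z) : 4 ≤ sepCount U {x, y, z} := by
  set X : Finset (Finset α) := {x, y, z} with hX
  have hxX : x ∈ X := by simp [hX]
  have hyX : y ∈ X := by simp [hX]
  have hzX : z ∈ X := by simp [hX]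
  have m1 := inf_mem_sigmaMeets (X := X) hxy hxX hyX
  have m2 := inf_mem_sigmaMeets (X := X) hxz hxX hzX
  have m3 := inf_mem_sigmaMeets (X := X) hyz hyX hzX
  have c1 := sdiff_sup_mem_sigmaCojoins (U := U) (X := X) hxy hxX hyX
  have c2 := sdiff_sup_mem_sigmaCojoins (U := U) (X := X) hxz hxX hzX
  have c3 := sdiff_sup_mem_sigmaCojoins (U := U) (X := X) hyz hyX hzX
  have e0 := empty_mem_sigmaMeets X
  have k12 : U \ (x ⊔ y) = U \ (x ⊔ z) → x ⊓ y ≠ x ⊓ z := fun h =>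
    inf_ne_inf_of_sup_eq_of_ne (sup_eq_sup_of_sdiff_eq hx hy hz h) hyz
  have k13 : U \ (x ⊔ y) = U \ (y ⊔ z) → x ⊓ y ≠ y ⊓ z := fun h => by
    have h' : U \ (y ⊔ x) = U \ (y ⊔ z) := by rwa [sup_comm y x]
    have := inf_ne_inf_of_sup_eq_of_ne (sup_eq_sup_of_sdiff_eq hy hx hz h') hxz
    rwa [inf_comm y x] at this
  have k23 : U \ (x ⊔ z) = U \ (y ⊔ z) → x ⊓ z ≠ y ⊓ z := fun h => by
    have h' : U \ (z ⊔ x) = U \ (z ⊔ y) := by rwa [sup_comm z x, sup_comm z y]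
    have := inf_ne_inf_of_sup_eq_of_ne (sup_eq_sup_of_sdiff_eq hz hx hy h') hxy
    rwa [inf_comm z x, inf_comm z y] at this
  unfold sepCount
  have hM1 : 0 < (sigmaMeets X).card := card_pos.2 ⟨_, e0⟩
  have hC1 : 0 < (sigmaCojoins U X).card := card_pos.2 ⟨_, c1⟩
  by_cases h12 : U \ (x ⊔ y) = U \ (x ⊔ z) <;> by_cases h13 : U \ (x ⊔ y) = U \ (y ⊔ z)
  · have h23 : U \ (x ⊔ z) = U \ (y ⊔ z) := h12.symm.trans h13
    have : 2 < (sigmaMeets X).card :=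
      two_lt_card.2 ⟨_, m1, _, m2, _, m3, k12 h12, k13 h13, k23 h23⟩
    omega
  · have hC : 1 < (sigmaCojoins U X).card := one_lt_card.2 ⟨_, c1, _, c3, h13⟩
    have hM : 1 < (sigmaMeets X).card := one_lt_card.2 ⟨_, m1, _, m2, k12 h12⟩
    omega
  · have hC : 1 < (sigmaCojoins U X).card := one_lt_card.2 ⟨_, c1, _, c2, h12⟩
    have hM : 1 < (sigmaMeets X).card := one_lt_card.2 ⟨_, m1, _, m3, k13 h13⟩
    omega
  · by_cases h23 : U \ (x ⊔ z) = U \ (y ⊔ z)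
    · have hC : 1 < (sigmaCojoins U X).card := one_lt_card.2 ⟨_, c1, _, c2, h12⟩
      have hM : 1 < (sigmaMeets X).card := one_lt_card.2 ⟨_, m2, _, m3, k23 h23⟩
      omega
    · have hC : 2 < (sigmaCojoins U X).card :=
        two_lt_card.2 ⟨_, c1, _, c2, _, c3, h12, h13, h23⟩
      omega

/-- **The square**: `X = {x, x + q, y, y + q}` with `x ≠ y` both `q`-free: meets + co-joins ≥ 5. -/
theorem five_le_sepCount_square {q : α} (hqU : q ∈ U) {x y : Finset α} (hx : x ⊆ U)
    (hy : y ⊆ U) (hqx : q ∉ x) (hqy : q ∉ y) (hxy : x ≠ y) :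
    5 ≤ sepCount U {x, insert q x, y, insert q y} := by
  set X : Finset (Finset α) := {x, insert q x, y, insert q y} with hX
  have hxX : x ∈ X := by simp [hX]
  have hx'X : insert q x ∈ X := by simp [hX]
  have hyX : y ∈ X := by simp [hX]
  have hy'X : insert q y ∈ X := by simp [hX]
  have hxx' : x ≠ insert q x := fun h => hqx (h ▸ mem_insert_self q x)
  have hyy' : y ≠ insert q y := fun h => hqy (h ▸ mem_insert_self q y)
  have hx'y' : insert q x ≠ insert q y := by
    intro h
    apply hxy
    have this : (insert q x).erase q = (insert q y).erase q := by rw [h]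
    rwa [erase_insert hqx, erase_insert hqy] at this
  -- the meets `x`, `y`, `insert q (x ⊓ y)` and `∅`
  have mx : x ∈ sigmaMeets X := by
    have := inf_mem_sigmaMeets (X := X) hxx' hxX hx'X
    rwa [inf_eq_left.2 (subset_insert q x)] at this
  have my : y ∈ sigmaMeets X := by
    have := inf_mem_sigmaMeets (X := X) hyy' hyX hy'X
    rwa [inf_eq_left.2 (subset_insert q y)] at this
  have mw : insert q (x ⊓ y) ∈ sigmaMeets X := by
    have := inf_mem_sigmaMeets (X := X) hx'y' hx'X hy'X
    rwa [inf_eq_inter, ← insert_inter_distrib, ← inf_eq_inter] at this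
  have e0 := empty_mem_sigmaMeets X
  have hwq : q ∈ insert q (x ⊓ y) := mem_insert_self q _
  have hwx : insert q (x ⊓ y) ≠ x := fun h => hqx (h ▸ hwq)
  have hwy : insert q (x ⊓ y) ≠ y := fun h => hqy (h ▸ hwq)
  have hw0 : insert q (x ⊓ y) ≠ ∅ := fun h => by
    rw [h] at hwq
    exact notMem_empty q hwq
  -- the co-joins `U \ (x + q)` and `U \ (y + q)`
  have cx : U \ insert q x ∈ sigmaCojoins U X := by
    have := sdiff_sup_mem_sigmaCojoins (U := U) (X := X) hxx' hxX hx'X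
    rwa [sup_eq_right.2 (subset_insert q x)] at this
  have cy : U \ insert q y ∈ sigmaCojoins U X := by
    have := sdiff_sup_mem_sigmaCojoins (U := U) (X := X) hyy' hyX hy'X
    rwa [sup_eq_right.2 (subset_insert q y)] at this
  have hcxy : U \ insert q x ≠ U \ insert q y := by
    intro h
    apply hx'y'
    rw [← Finset.sdiff_sdiff_eq_self (insert_subset hqU hx), h,
      Finset.sdiff_sdiff_eq_self (insert_subset hqU hy)]
  unfold sepCount
  have hC : 1 < (sigmaCojoins U X).card := one_lt_card.2 ⟨_, cx, _, cy, hcxy⟩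
  have hM : 2 < (sigmaMeets X).card := by
    by_cases hx0 : x = ∅
    · have hy0 : y ≠ ∅ := fun h => hxy (hx0.trans h.symm)
      exact two_lt_card.2 ⟨_, e0, _, my, _, mw, Ne.symm hy0, Ne.symm hw0, Ne.symm hwy⟩
    · exact two_lt_card.2 ⟨_, e0, _, mx, _, mw, Ne.symm hx0, Ne.symm hw0, Ne.symm hwx⟩
  omega

end Small

section Credit

variable {q : α} {U : Finset α} {X : Finset (Finset α)}

/-- The `q`-edges of `X` itself are the partners. -/
theorem qEdges_self_eq_partners (q : α) (X : Finset (Finset α)) : qEdges q X = partners q X := by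
  ext d
  rw [mem_qEdges, mem_partners]

/-- The projection loses exactly the partners: `|π_q X| + |K| = |X|`. -/
theorem card_image_erase_add_card_partners (q : α) (X : Finset (Finset α)) :
    (X.image fun x => x.erase q).card + (partners q X).card = X.card := by
  rw [← qEdges_self_eq_partners, card_eq_card_image_erase_add_card_qEdges q X]

/-- **The credit lemma**: at a point `q ∈ U` of a family with at least four members, the
`q`-edges of the two halves pay the partners, given the strict separated inequality on
`U \ q` (used only for three or more partners). -/
theorem card_partners_le_card_qEdges (hqU : q ∈ U) (h4 : 4 ≤ X.card)
    (ih : ∀ K : Finset (Finset α), (∀ x ∈ K, x ⊆ U.erase q) →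
      K.card + (if 3 ≤ K.card then 1 else 0) ≤ sepCount (U.erase q) K)
    (hX : ∀ x ∈ X, x ⊆ U) :
    (partners q X).card ≤
      (qEdges q (sigmaMeets X)).card + (qEdges q (sigmaCojoins U X)).card := by
  set K := partners q X with hK
  rcases Nat.lt_or_ge K.card 3 with hlt | hge
  · interval_cases hc : K.card
    · omega
    · -- one partner: a third member pays
      obtain ⟨x, hKx⟩ := card_eq_one.1 hc
      have hx : x ∈ K := by rw [hKx]; exact mem_singleton_self x
      have hx' := mem_partners.1 hx
      have hlt2 : ({x, insert q x} : Finset (Finset α)).card < X.card := by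
        have := card_le_two (a := x) (b := insert q x)
        omega
      obtain ⟨u, hu, hu'⟩ := exists_mem_notMem_of_card_lt_card hlt2
      simp only [mem_insert, mem_singleton, not_or] at hu'
      rcases exists_mem_qEdges_of_third hqU hx hu hu'.1 hu'.2 with h | h
      · have := card_pos.2 h
        omega
      · have := card_pos.2 h
        omega
    · -- two partners: their meet and their co-join
      obtain ⟨x, y, hxy, hKxy⟩ := card_eq_two.1 hc
      have hx : x ∈ K := by rw [hKxy]; simp
      have hy : y ∈ K := by rw [hKxy]; simp
      have h1 := card_pos.2 ⟨_, inf_mem_qEdges_sigmaMeets hx hy hxy⟩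
      have h2 := card_pos.2 ⟨_, sdiff_sup_mem_qEdges_sigmaCojoins hqU hx hy hxy⟩
      omega
  · -- three or more partners: the strict inequality for `K` on `U \ q`
    have hKsub : ∀ x ∈ K, x ⊆ U.erase q := by
      intro x hx
      have hx' := mem_partners.1 hx
      exact subset_erase.2 ⟨hX x hx'.1, hx'.2.1⟩
    have hih := ih K hKsub
    rw [if_pos hge] at hih
    have hM : sigmaMeets K ⊆ insert ∅ (qEdges q (sigmaMeets X)) := by
      intro E hE
      rcases mem_sigmaMeets.1 hE with rfl | ⟨x, hx, y, hy, hxy, rfl⟩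
      · exact mem_insert_self _ _
      · exact mem_insert_of_mem (inf_mem_qEdges_sigmaMeets hx hy hxy)
    have hC : sigmaCojoins (U.erase q) K ⊆ qEdges q (sigmaCojoins U X) := by
      intro E hE
      obtain ⟨x, hx, y, hy, hxy, rfl⟩ := mem_sigmaCojoins.1 hE
      exact sdiff_sup_mem_qEdges_sigmaCojoins hqU hx hy hxy
    have hM' := (card_le_card hM).trans (card_insert_le _ _)
    have hC' := card_le_card hC
    unfold sepCount at hih
    omega

end Credit

end PercRepro.MSTight
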